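import Summits.CriticalPhenomena.PercolationContinuityZ3.Theorems.PercNearOneGluingNoHeavyQuantCountDP
import Literature.Combinatorics.StablePolynomials.GurvitsCapacityUnivariate
import Summits.CriticalPhenomena.PercolationContinuityZ3.Theorems.PercNearOneGluingNoHeavyQuantSurplusCore
import HarnessLib

/-!
# FAR beyond trees: the SURPLUS fixed-set FAR inequality at layer two — `P(N ≤ 2)·(E N − 3) ≤ 1 − η` for independent trials with
# success probabilities in `[η, 1]` and mean `E N ≥ 4` (the analytic core of LEMMA L: the long rows of the weakest-hair bet)

builds on p205010 (kernel theorem, internal audit signed; external expert review pending)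

Support file (`--supports stmt-CriticalPhenomena-4575`), seat `prim-cert-1` (gen 37); memo `prim-cert-1/FROM-prim-cert-1-g37-SURPLUS-FAR.md`.
This is inequality **(∗)** of `prim-cert-1/FROM-prim-cert-1-g34-UNIVERSAL-WITNESS.md` §3 at `j = 2` — the one-Poisson-binomial inequality to
which LEMMA L ("the long rows of `W(μ_W)` never bind") reduces; together with `Quant.CountDP.deficit_far_two` (p375927, the short rows) it is
the whole analytic content of THM B there ("`W(μ_W)` is a hair-only certificate for `SunFAR K 2` whenever `η(Σh − 4) ≤ 2(F − η)`").
Gen 34 proved it on paper through pairwise equalisation, the binomial extremal case and the Anderson–Samuels binomial-vs-Poisson inequality;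
the proof here is ELEMENTARY: Cantelli when `η·E N ≤ 4`, and when `η·E N > 4` the exponential-moment bound `θ²·P(N ≤ 2) ≤ E θ^N`, AM–GM on
`E θ^N = Π_k (1 − (1−θ)p_k)`, the choice `θ = 2Q/((m−2)·E N)` (`Q = m − E N`, the expected number of failures among the `m` trials), and the
deterministic inequality `m E²(E−3) Q^{m−3} ≤ 4(m−2)^{m−2}` on `E² ≥ 4m`.  Same local notation `PB[p, m] b` as `…QuantCountDP.lean`
(probability that exactly `b` of the first `m` trials succeed); pure real algebra on the recursion plus `Real.exp`; no definitions, no sorries,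
standard axioms.

* `Quant.CountDP.mgf_eq_prod` — `Σ_{b ≤ m} PB[p, m] b · θ^b = Π_{k<m} (1 − p k + θ·p k)` (every real `θ`);
  `Quant.CountDP.sq_mul_cdf_three_le_mgf` — `θ²·P(S_m ≤ 2) ≤ Σ_b PB[p, m] b θ^b` for `0 ≤ θ ≤ 1`.
* `Quant.CountDP.cdf_three_le_chernoff` — `P(S_m ≤ 2) ≤ (E/2)²·(Q/(m−2))^{m−2}` (`E = Σ_{k<m} p k ≥ 4`, `Q = m − E > 0`): exponential
  moment + AM–GM (`Literature.Combinatorics.StablePolynomials.Gurvits.finset_prod_le_arith_mean_pow`) at `θ = 2Q/((m−2)E)`.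
* the deterministic step `m E²(E−3)(m−E)^{m−3} ≤ 4(m−2)^{m−2}` on `4m ≤ E²` is `Quant.CountDP.surplus_core` (`…QuantSurplusCore.lean`:
  `m ≥ 36` via `(1−t)^{m−3} ≤ e^{−t(m−3)} ≤ 720/(t(m−3))⁶`; `5 ≤ m ≤ 35` by one rational evaluation per `m`).
* **`Quant.CountDP.surplus_far_two`** — for `η ≤ p k ≤ 1` (`k < m`; any real `η`) and `4 ≤ Σ_{k<m} p k`:
  `(Σ_{i<3} PB[p, m] i) · (Σ_{k<m} p k − 3) ≤ 1 − η`, i.e. `P(S_m ≥ 3) ≥ (η + u)/(1 + u)` with `u = E N − 4 ≥ 0`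
  (at `u = 0` the fixed-set FAR value `η`; "a surplus `u` of mean above `4` buys `(1−η)u/(1+u)`").
Numerical re-check (seat folder `work/py/star2check*.py`): the Chernoff–AM–GM bound has worst ratio `0.38` to the target over the whole region
`η·E N > 4`; the statement itself is tight only at the all-sure corner (g34 `starq2.py`: 2.1 M structured instances, minimum margin `0`).  Nearest prior art: Cantelli's inequality, the exponential-moment (Chernoff) bound and AM–GM are folklore; the packaged
statement is [this work].
-/

noncomputable section

namespace Summit.CriticalPhenomena.PercolationContinuityZ3.Theorems

namespace Quant

namespace CountDP

open Finset

/-- `PB[p, m] b` = probability that exactly `b` of the first `m` independent trials succeed (recursion on `m`, as in `…QuantCountDP.lean`). -/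
local notation3 "PB[" p ", " m "]" =>
  (Nat.rec (motive := fun _ => ℕ → ℝ) (fun b => if b = 0 then (1 : ℝ) else 0)
    (fun n f b => (p : ℕ → ℝ) n * (if b = 0 then (0 : ℝ) else f (b - 1)) + (1 - (p : ℕ → ℝ) n) * f b) (m : ℕ))

variable (p : ℕ → ℝ)

/-! ### Small bookkeeping (local copies, so that this file depends on `…QuantCountDP` only) -/

/-- The cdf is at most one. [folklore] -/
private theorem cdf_le_one_aux (hp : ∀ k, 0 ≤ p k ∧ p k ≤ 1) (m a : ℕ) : ∑ i ∈ Finset.range a, PB[p, m] i ≤ 1 := by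
  rcases Nat.lt_or_ge m a with h | h
  · rw [← Finset.sum_range_add_sum_Ico (fun i => PB[p, m] i) (show m + 1 ≤ a by omega), PB_sum_eq_one]
    have : ∑ i ∈ Finset.Ico (m + 1) a, PB[p, m] i = 0 :=
      Finset.sum_eq_zero fun i hi => PB_eq_zero_of_lt p m i (by rw [Finset.mem_Ico] at hi; omega)
    rw [this, add_zero]
  · calc ∑ i ∈ Finset.range a, PB[p, m] i ≤ ∑ i ∈ Finset.range (m + 1), PB[p, m] i :=
          Finset.sum_le_sum_of_subset_of_nonneg (Finset.range_mono (by omega)) fun i _ _ => PB_nonneg p hp m i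
      _ = 1 := PB_sum_eq_one p m

/-- The cdf is nonnegative. [folklore] -/
private theorem cdf_nonneg_aux (hp : ∀ k, 0 ≤ p k ∧ p k ≤ 1) (m a : ℕ) : 0 ≤ ∑ i ∈ Finset.range a, PB[p, m] i :=
  Finset.sum_nonneg fun i _ => PB_nonneg p hp m i

/-- Squared deviation from any centre: `Σ_{b ≤ m} (c − b)² PB[p, m] b = (c − Σ_{k<m} p k)² + Σ_{k<m} p k (1 − p k)`
(local copy of `Quant.CountDP.sum_sq_dev`). [folklore] -/
private theorem sum_sq_dev_aux (m : ℕ) : ∀ c : ℝ,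
    ∑ b ∈ Finset.range (m + 1), (c - b) ^ 2 * PB[p, m] b =
      (c - ∑ k ∈ Finset.range m, p k) ^ 2 + ∑ k ∈ Finset.range m, p k * (1 - p k) := by
  induction m with
  | zero => intro c; simp
  | succ m ih =>
    intro c
    have hsplit : ∑ b ∈ Finset.range (m + 2), (c - b) ^ 2 * PB[p, m + 1] b =
        p m * ∑ b ∈ Finset.range (m + 1), (c - 1 - b) ^ 2 * PB[p, m] b +
          (1 - p m) * ∑ b ∈ Finset.range (m + 1), (c - b) ^ 2 * PB[p, m] b := by
      have e1 : ∑ b ∈ Finset.range (m + 2), (c - b) ^ 2 * PB[p, m + 1] b =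
          ∑ b ∈ Finset.range (m + 2), ((c - b) ^ 2 * (p m * (if b = 0 then (0 : ℝ) else PB[p, m] (b - 1))) +
            (c - b) ^ 2 * ((1 - p m) * PB[p, m] b)) :=
        Finset.sum_congr rfl fun b _ => by rw [PB_succ]; ring
      rw [e1, Finset.sum_add_distrib]
      congr 1
      · rw [Finset.sum_range_succ', Finset.mul_sum]
        simp only [if_true, mul_zero, add_zero, Nat.add_one_ne_zero, if_false, Nat.add_sub_cancel]
        refine Finset.sum_congr rfl fun b _ => ?_
        push_cast
        ring
      · rw [Finset.sum_range_succ, PB_eq_zero_of_lt p m (m + 1) (by omega), mul_zero, mul_zero, add_zero, Finset.mul_sum]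
        refine Finset.sum_congr rfl fun b _ => ?_
        ring
    rw [hsplit, ih (c - 1), ih c, Finset.sum_range_succ, Finset.sum_range_succ]
    ring

/-! ### The exponential moment -/

/-- **Exponential moment as a product**: `Σ_{b ≤ m} PB[p, m] b · θ^b = Π_{k<m} (1 − p k + θ · p k)` for every real `θ`
(`E θ^{S_m} = Π_k E θ^{ξ_k}`). [folklore] -/
theorem mgf_eq_prod (θ : ℝ) : ∀ m : ℕ,
    ∑ b ∈ Finset.range (m + 1), PB[p, m] b * θ ^ b = ∏ k ∈ Finset.range m, (1 - p k + θ * p k) := by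
  intro m
  induction m with
  | zero => simp
  | succ m ih =>
    -- split `PB[p, m+1] b = p m · [b ≠ 0] PB[p, m] (b−1) + (1 − p m) · PB[p, m] b` and shift the first sum
    have hsplit : ∑ b ∈ Finset.range (m + 2), PB[p, m + 1] b * θ ^ b =
        p m * θ * ∑ b ∈ Finset.range (m + 1), PB[p, m] b * θ ^ b +
          (1 - p m) * ∑ b ∈ Finset.range (m + 1), PB[p, m] b * θ ^ b := by
      have e1 : ∑ b ∈ Finset.range (m + 2), PB[p, m + 1] b * θ ^ b =
          ∑ b ∈ Finset.range (m + 2), ((p m * (if b = 0 then (0 : ℝ) else PB[p, m] (b - 1))) * θ ^ b +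
            ((1 - p m) * PB[p, m] b) * θ ^ b) :=
        Finset.sum_congr rfl fun b _ => by rw [PB_succ]; ring
      rw [e1, Finset.sum_add_distrib]
      congr 1
      · rw [Finset.sum_range_succ', Finset.mul_sum]
        simp only [if_true, mul_zero, zero_mul, add_zero, Nat.add_one_ne_zero, if_false, Nat.add_sub_cancel]
        refine Finset.sum_congr rfl fun b _ => ?_
        rw [pow_succ]
        ring
      · rw [Finset.sum_range_succ, PB_eq_zero_of_lt p m (m + 1) (by omega), mul_zero, zero_mul, add_zero, Finset.mul_sum]
        refine Finset.sum_congr rfl fun b _ => ?_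
        ring
    rw [hsplit, ih, Finset.prod_range_succ]
    ring

/-- The exponential moment dominates `θ²·P(S_m ≤ 2)` for `0 ≤ θ ≤ 1` (`θ^b ≥ θ²` for `b ≤ 2`; `m ≥ 2`). [folklore] -/
theorem sq_mul_cdf_three_le_mgf (hp : ∀ k, 0 ≤ p k ∧ p k ≤ 1) {θ : ℝ} (hθ0 : 0 ≤ θ) (hθ1 : θ ≤ 1) (m : ℕ) (hm : 2 ≤ m) :
    θ ^ 2 * ∑ i ∈ Finset.range 3, PB[p, m] i ≤ ∑ b ∈ Finset.range (m + 1), PB[p, m] b * θ ^ b := by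
  calc θ ^ 2 * ∑ i ∈ Finset.range 3, PB[p, m] i = ∑ i ∈ Finset.range 3, PB[p, m] i * θ ^ 2 := by
        rw [Finset.mul_sum]; exact Finset.sum_congr rfl fun i _ => by ring
    _ ≤ ∑ i ∈ Finset.range 3, PB[p, m] i * θ ^ i := by
        refine Finset.sum_le_sum fun i hi => mul_le_mul_of_nonneg_left ?_ (PB_nonneg p hp m i)
        exact pow_le_pow_of_le_one hθ0 hθ1 (by rw [Finset.mem_range] at hi; omega)
    _ ≤ ∑ b ∈ Finset.range (m + 1), PB[p, m] b * θ ^ b :=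
        Finset.sum_le_sum_of_subset_of_nonneg (Finset.range_mono (by omega))
          fun b _ _ => mul_nonneg (PB_nonneg p hp m b) (pow_nonneg hθ0 b)

/-- All trials sure: if `p k = 1` for every `k < m` then `PB[p, m] b = 0` for every `b < m`. [folklore] -/
theorem PB_eq_zero_of_all_one : ∀ m : ℕ, (∀ k, k < m → p k = 1) → ∀ b, b < m → PB[p, m] b = 0 := by
  intro m
  induction m with
  | zero => intro _ b hb; omega
  | succ m ih =>
    intro h1 b hb
    have hm1 : p m = 1 := h1 m (by omega)
    cases b with
    | zero => rw [PB_succ_zero, hm1]; ring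
    | succ b => rw [PB_succ_succ, hm1, ih (fun k hk => h1 k (by omega)) b (by omega)]; ring

/-- **The Chernoff–AM–GM bound**: with `E = Σ_{k<m} p k ≥ 4` and `Q = m − E > 0` (so `m ≥ 5`),
`P(S_m ≤ 2) ≤ (E/2)² · (Q/(m−2))^{m−2}` — the exponential-moment bound `θ² P(S_m ≤ 2) ≤ Π_k (1 − (1−θ)p k) ≤ (1 − (1−θ)E/m)^m`
(AM–GM) at `θ = 2Q/((m−2)E)`, where `1 − (1−θ)E/m = Q/(m−2)`. [this work] -/
theorem cdf_three_le_chernoff (hp : ∀ k, 0 ≤ p k ∧ p k ≤ 1) (m : ℕ) (hm : 5 ≤ m)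
    (hE4 : 4 ≤ ∑ k ∈ Finset.range m, p k) (hQ : ∑ k ∈ Finset.range m, p k < m) :
    ∑ i ∈ Finset.range 3, PB[p, m] i ≤
      ((∑ k ∈ Finset.range m, p k) / 2) ^ 2 * (((m : ℝ) - ∑ k ∈ Finset.range m, p k) / ((m : ℝ) - 2)) ^ (m - 2) := by
  set E := ∑ k ∈ Finset.range m, p k with hEdef
  set C := ∑ i ∈ Finset.range 3, PB[p, m] i with hCdef
  have hm2 : (2 : ℝ) < m := by exact_mod_cast (show 2 < m by omega)
  have hA : (0 : ℝ) < (m : ℝ) - 2 := by linarith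
  have hE0 : (0 : ℝ) < E := by linarith
  set y := ((m : ℝ) - E) / ((m : ℝ) - 2) with hydef
  have hy0 : 0 < y := div_pos (by linarith) hA
  -- the parameter `θ = (2/E)·y = 2Q/((m−2)E) ∈ (0, 1]`
  set θ := 2 / E * y with hθdef
  have hθ0 : 0 < θ := mul_pos (div_pos two_pos hE0) hy0
  have hθ1 : θ ≤ 1 := by
    rw [hθdef, hydef, div_mul_div_comm, div_le_one (mul_pos hE0 hA)]
    nlinarith
  -- exponential moment ≥ θ² C, and = Π (1 − p k + θ p k)
  have h1 := sq_mul_cdf_three_le_mgf p hp hθ0.le hθ1 m (by omega)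
  rw [mgf_eq_prod p θ m, ← hCdef] at h1
  -- AM–GM on the product
  have hz : ∀ k ∈ Finset.range m, 0 ≤ 1 - p k + θ * p k := fun k _ => by nlinarith [hp k, hθ0]
  have h2 := Literature.Combinatorics.StablePolynomials.Gurvits.finset_prod_le_arith_mean_pow (Finset.range m)
    (fun k => 1 - p k + θ * p k) hz ⟨0, Finset.mem_range.2 (by omega)⟩
  rw [Finset.card_range] at h2
  -- the mean of the factors is `y`
  have hmean : (∑ k ∈ Finset.range m, (1 - p k + θ * p k)) / (m : ℝ) = y := by
    have e1 : ∑ k ∈ Finset.range m, (1 - p k + θ * p k) = (m : ℝ) - E + θ * E := by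
      rw [Finset.sum_add_distrib, Finset.sum_sub_distrib, Finset.sum_const, Finset.card_range, ← Finset.mul_sum, ← hEdef]
      simp
    rw [e1, hθdef, div_mul_eq_mul_div, div_mul_cancel_of_imp (fun h => absurd h hE0.ne')]
    rw [hydef]
    field_simp
    ring
  rw [hmean] at h2
  -- so `θ² C ≤ y^m = y² · y^{m−2}` and `θ² = (4/E²) y²`
  have h3 : θ ^ 2 * C ≤ y ^ m := h1.trans h2
  obtain ⟨n, hn⟩ : ∃ n, m = n + 2 := ⟨m - 2, by omega⟩
  have hmn : m - 2 = n := by omega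
  rw [hmn]
  rw [hn, pow_add] at h3
  rw [hθdef] at h3
  -- divide by `y² > 0`
  have hy2 : 0 < y ^ 2 := pow_pos hy0 2
  have h4 : (2 / E) ^ 2 * C ≤ y ^ n := by
    have e : (2 / E * y) ^ 2 * C = ((2 / E) ^ 2 * C) * y ^ 2 := by ring
    rw [e] at h3
    have h3' : ((2 / E) ^ 2 * C) * y ^ 2 ≤ y ^ n * y ^ 2 := by linarith
    exact le_of_mul_le_mul_right h3' hy2
  have e2 : (2 / E) ^ 2 = 4 / E ^ 2 := by rw [div_pow]; norm_num
  rw [e2] at h4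
  have hE2 : 0 < E ^ 2 := pow_pos hE0 2
  have h5 : 4 * C ≤ y ^ n * E ^ 2 := by
    have h4' : 4 * C / E ^ 2 ≤ y ^ n := by rwa [div_mul_eq_mul_div] at h4
    exact (div_le_iff₀ hE2).1 h4'
  have e3 : (E / 2) ^ 2 * y ^ n = y ^ n * E ^ 2 / 4 := by ring
  rw [e3]
  linarith

/-! ### The surplus inequality -/

/-- **THE SURPLUS FIXED-SET FAR INEQUALITY AT LAYER TWO.**  For independent trials with success probabilities `η ≤ p k ≤ 1` (`k < m`;
`η` any real, in applications the least hair weight) and mean `Σ_{k<m} p k ≥ 4`:  `P(S_m ≤ 2) · (Σ_{k<m} p k − 3) ≤ 1 − η`, i.e. `P(S_m ≥ 3) ≥ (η + u)/(1 + u)` where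
`u = Σ p k − 4` (the one-Poisson-binomial inequality (∗) behind LEMMA L of the weakest-hair-bet certificate, layer `j = 2`). [this work] -/
theorem surplus_far_two (hp : ∀ k, 0 ≤ p k ∧ p k ≤ 1) {η : ℝ} {m : ℕ} (hη : ∀ k, k < m → η ≤ p k)
    (hE4 : 4 ≤ ∑ k ∈ Finset.range m, p k) :
    (∑ i ∈ Finset.range 3, PB[p, m] i) * (∑ k ∈ Finset.range m, p k - 3) ≤ 1 - η := by
  set E := ∑ k ∈ Finset.range m, p k with hEdef
  set C := ∑ i ∈ Finset.range 3, PB[p, m] i with hCdef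
  have hC0 : 0 ≤ C := by rw [hCdef]; exact cdf_nonneg_aux p hp m 3
  have hC1 : C ≤ 1 := by rw [hCdef]; exact cdf_le_one_aux p hp m 3
  have hEm : E ≤ m := by
    rw [hEdef]
    have := Finset.sum_le_sum (s := Finset.range m) (f := p) (g := fun _ => (1 : ℝ)) fun k _ => (hp k).2
    simpa using this
  have hEη : (m : ℝ) * η ≤ E := by
    rw [hEdef]
    have := Finset.sum_le_sum (s := Finset.range m) (f := fun _ => η) (g := p) fun k hk => hη k (Finset.mem_range.1 hk)
    simpa using this
  have hm4 : 4 ≤ m := by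
    by_contra h
    have : (m : ℝ) ≤ 3 := by exact_mod_cast (show m ≤ 3 by omega)
    linarith
  have hη1 : η ≤ 1 := (hη 0 (by omega)).trans (hp 0).2
  have hE0 : 0 ≤ E := by linarith
  by_cases hcase : η * E ≤ 4
  · ----------------------------------------------------------------
    -- Case `η·E ≤ 4`: Cantelli — `C·(s² + W) ≤ W` with `s = E − 2`, `W = (1−η)E ≥ Var`
    ----------------------------------------------------------------
    set s := E - 2 with hsdef
    have hs0 : 0 < s := by rw [hsdef]; linarith
    set W := (1 - η) * E with hWdef
    have hW0 : 0 ≤ W := mul_nonneg (by linarith) hE0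
    have hvar : ∑ k ∈ Finset.range m, p k * (1 - p k) ≤ W := by
      rw [hWdef, hEdef, Finset.mul_sum]
      exact Finset.sum_le_sum fun k hk => by
        have := hη k (Finset.mem_range.1 hk)
        nlinarith [(hp k).1]
    -- Markov step on the squares: for `b ≤ 2`, `(E + u − b)² ≥ (s + u)²`
    have hcant : ∀ u : ℝ, 0 ≤ u → C * (s + u) ^ 2 ≤ u ^ 2 + W := by
      intro u hu
      have hmk : C * (s + u) ^ 2 ≤ ∑ b ∈ Finset.range (m + 1), (E + u - b) ^ 2 * PB[p, m] b := by
        calc C * (s + u) ^ 2 = ∑ i ∈ Finset.range 3, (s + u) ^ 2 * PB[p, m] i := by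
              rw [hCdef, Finset.sum_mul]; exact Finset.sum_congr rfl fun i _ => by ring
          _ ≤ ∑ i ∈ Finset.range 3, (E + u - i) ^ 2 * PB[p, m] i := by
              refine Finset.sum_le_sum fun i hi => mul_le_mul_of_nonneg_right ?_ (PB_nonneg p hp m i)
              have hi2 : (i : ℝ) ≤ 2 := by exact_mod_cast (show i ≤ 2 by rw [Finset.mem_range] at hi; omega)
              have h1 : s + u ≤ E + u - i := by rw [hsdef]; linarith
              exact pow_le_pow_left₀ (by linarith) h1 2
          _ ≤ ∑ b ∈ Finset.range (m + 1), (E + u - b) ^ 2 * PB[p, m] b :=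
              Finset.sum_le_sum_of_subset_of_nonneg (Finset.range_mono (by omega))
                fun b _ _ => mul_nonneg (sq_nonneg _) (PB_nonneg p hp m b)
      rw [sum_sq_dev_aux p m (E + u), ← hEdef] at hmk
      have e : (E + u - E) ^ 2 = u ^ 2 := by ring
      rw [e] at hmk
      linarith
    have hC := hcant (W / s) (div_nonneg hW0 hs0.le)
    have hkey : C * (s ^ 2 + W) ≤ W := by
      have e1 : (s + W / s) ^ 2 = (s ^ 2 + W) ^ 2 / s ^ 2 := by field_simp
      have e2 : (W / s) ^ 2 + W = W * (s ^ 2 + W) / s ^ 2 := by field_simp; ring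
      rw [e1, e2] at hC
      have hs2 : 0 < s ^ 2 := by positivity
      have hsw : 0 < s ^ 2 + W := by positivity
      have h3 : C * (s ^ 2 + W) ^ 2 ≤ W * (s ^ 2 + W) := by
        have := mul_le_mul_of_nonneg_right hC hs2.le
        rwa [mul_div_assoc', div_mul_cancel₀ _ hs2.ne', div_mul_cancel₀ _ hs2.ne'] at this
      nlinarith
    -- finish: `C(E−3)(s²+W) ≤ (E−3)W ≤ (1−η)(s²+W)` because `E(E−4+η) ≤ (E−2)²` iff `ηE ≤ 4`
    have hsw : 0 < s ^ 2 + W := by positivity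
    have hE3 : 0 ≤ E - 3 := by linarith
    have hpoly : (E - 3) * W ≤ (1 - η) * (s ^ 2 + W) := by
      rw [hWdef, hsdef]
      have h1η : 0 ≤ 1 - η := by linarith
      nlinarith [mul_le_mul_of_nonneg_left hcase h1η, mul_nonneg h1η hE0]
    have h1 : C * (E - 3) * (s ^ 2 + W) ≤ (1 - η) * (s ^ 2 + W) := by
      calc C * (E - 3) * (s ^ 2 + W) = (E - 3) * (C * (s ^ 2 + W)) := by ring
        _ ≤ (E - 3) * W := mul_le_mul_of_nonneg_left hkey hE3
        _ ≤ (1 - η) * (s ^ 2 + W) := hpoly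
    exact le_of_mul_le_mul_right h1 hsw
  · ----------------------------------------------------------------
    -- Case `η·E > 4`: then `4m < E²`; Chernoff–AM–GM bound and the deterministic inequality
    ----------------------------------------------------------------
    push Not at hcase
    have hm0 : (0 : ℝ) < m := by exact_mod_cast (show 0 < m by omega)
    have hηE : η ≤ E / m := by rw [le_div_iff₀ hm0]; linarith
    have hE2 : 4 * (m : ℝ) ≤ E ^ 2 := by
      have h1 : η * E ≤ E / m * E := mul_le_mul_of_nonneg_right hηE hE0
      have h2 : (4 : ℝ) * m < E / m * E * m := by nlinarith
      have e : E / m * E * m = E ^ 2 := by field_simp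
      linarith [e ▸ h2]
    by_cases hQ0 : E = m
    · -- all trials sure: `C = 0`
      have hall : ∀ k, k < m → p k = 1 := by
        have hsum0 : ∑ k ∈ Finset.range m, (1 - p k) = 0 := by
          rw [Finset.sum_sub_distrib, Finset.sum_const, Finset.card_range, ← hEdef, hQ0]; simp
        have h0 := (Finset.sum_eq_zero_iff_of_nonneg (fun k _ => by linarith [(hp k).2])).1 hsum0
        intro k hk
        have := h0 k (Finset.mem_range.2 hk)
        linarith
      have hC00 : C = 0 := by
        rw [hCdef]
        exact Finset.sum_eq_zero fun i hi => PB_eq_zero_of_all_one p m hall i (by rw [Finset.mem_range] at hi; omega)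
      rw [hC00, zero_mul]
      linarith
    · have hElt : E < m := lt_of_le_of_ne hEm hQ0
      have hm5 : 5 ≤ m := by
        by_contra h
        have hm4' : m = 4 := by omega
        have : (m : ℝ) = 4 := by exact_mod_cast hm4'
        nlinarith
      have hchern := cdf_three_le_chernoff p hp m hm5 (by rw [← hEdef]; exact hE4) (by rw [← hEdef]; exact hElt)
      rw [← hEdef, ← hCdef] at hchern
      have hcore := surplus_core m hm5 E hE0 hElt hE2
      have hm2 : (0 : ℝ) < (m : ℝ) - 2 := by
        have : (5 : ℝ) ≤ m := by exact_mod_cast hm5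
        linarith
      have hQpos : 0 < (m : ℝ) - E := by linarith
      -- `(E/2)²·((m−E)/(m−2))^{m−2}·(E−3) ≤ (m−E)/m`
      obtain ⟨n, hn⟩ : ∃ n, m - 2 = n + 1 ∧ m - 3 = n := ⟨m - 3, by omega, by omega⟩
      rw [hn.1] at hchern hcore
      rw [hn.2] at hcore
      have hkey : E ^ 2 * (E - 3) * ((m : ℝ) - E) ^ (n + 1) * m ≤ ((m : ℝ) - E) * (4 * ((m : ℝ) - 2) ^ (n + 1)) := by
        have := mul_le_mul_of_nonneg_right hcore hQpos.le
        calc E ^ 2 * (E - 3) * ((m : ℝ) - E) ^ (n + 1) * m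
            = (m : ℝ) * E ^ 2 * (E - 3) * ((m : ℝ) - E) ^ n * ((m : ℝ) - E) := by rw [pow_succ]; ring
          _ ≤ 4 * ((m : ℝ) - 2) ^ (n + 1) * ((m : ℝ) - E) := this
          _ = ((m : ℝ) - E) * (4 * ((m : ℝ) - 2) ^ (n + 1)) := by ring
      have hmid : (E / 2) ^ 2 * (((m : ℝ) - E) / ((m : ℝ) - 2)) ^ (n + 1) * (E - 3) ≤ ((m : ℝ) - E) / m := by
        have hden : 0 < 4 * ((m : ℝ) - 2) ^ (n + 1) := by positivity
        have e1 : (E / 2) ^ 2 * (((m : ℝ) - E) / ((m : ℝ) - 2)) ^ (n + 1) * (E - 3) =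
            E ^ 2 * (E - 3) * ((m : ℝ) - E) ^ (n + 1) / (4 * ((m : ℝ) - 2) ^ (n + 1)) := by
          rw [div_pow, div_pow]; field_simp; ring
        rw [e1, div_le_div_iff₀ hden hm0]
        exact hkey
      have hlast : ((m : ℝ) - E) / m ≤ 1 - η := by
        rw [div_le_iff₀ hm0]; nlinarith
      have hE3 : 0 ≤ E - 3 := by linarith
      calc C * (E - 3) ≤ (E / 2) ^ 2 * (((m : ℝ) - E) / ((m : ℝ) - 2)) ^ (n + 1) * (E - 3) :=
            mul_le_mul_of_nonneg_right hchern hE3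
        _ ≤ ((m : ℝ) - E) / m := hmid
        _ ≤ 1 - η := hlast

end CountDP

end Quant

end Summit.CriticalPhenomena.PercolationContinuityZ3.Theorems

end
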